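import Summits.AnomalousDissipation.AnomalousDissipation.Theorems.BaireTransferRobustLoudUpgradeStubSteadyPersist
import Literature.Analysis.FluidPDE.SteadyNSLatticeLinearised

/-!
# Part lemma `lsFamily_latticeDist` of the stub `stub_lsFamily` of the line `malkin-cone-group-orbits`
# (crux stmt-AnomalousDissipation-1144, companion lead c2, "Lyapunov–Schmidt crossing"):
# the `ℓ²`-norm of the lattice state is the weighted `H²`-type Fourier quantity

Registered part lemma (Pi-form):
`∀ (z : lp (fun _ : Fin 3 → ℤ => EuclideanSpace ℂ (Fin 3)) 2) (w : UnitAddTorus (Fin 3) → EuclideanSpace ℝ (Fin 3)),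
 (z : (Fin 3 → ℤ) → EuclideanSpace ℂ (Fin 3)) 0 = 0 →
 ((fun mm : Fin 3 → ℤ => (((freqNormSq mm)⁻¹ : ℝ) : ℂ)) • ((z : (Fin 3 → ℤ) → EuclideanSpace ℂ (Fin 3)))) =
   mFourierCoeff (complexify ∘ w) →
 (∑' k : Fin 3 → ℤ, freqNormSq k ^ 2 * ‖mFourierCoeff (complexify ∘ w) k‖ ^ 2) = ‖z‖ ^ 2`.

Content.  In the Lyapunov–Schmidt reduction for steady Navier–Stokes on `T³` carried out on the Fourier
lattice (`Literature.Analysis.FluidPDE.SteadyLattice.*`), a state is a square-summable family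
`z : ℤ³ → ℂ³` with `z k = |k|² ŵ(k)`, and the map `cf z := (fun mm => ((|mm|²)⁻¹ : ℂ)) • ⇑z` recovers the
Fourier coefficients `ŵ = mFourierCoeff (complexify ∘ w)` of the real field `w`.  The uniqueness clause of
the implicit function theorem is phrased in the `ℓ²`-norm of the lattice space; classically this is the
weighted quantity `∑ₖ |k|⁴ ‖ŵ(k)‖²`.  This file records the bookkeeping identity between the two.  It is pure
lattice algebra: `w` enters only through `mFourierCoeff (complexify ∘ w)`.

Proof idea (folklore).  Rewrite `ŵ = cf z`; termwise `‖(cf z) k‖ = |k|⁻² ‖z k‖` (`SteadyLattice.norm_cf`), so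
for `k ≠ 0` the summand is `|k|⁴ · |k|⁻⁴ ‖z k‖² = ‖z k‖²` (`|k|² ≠ 0` by `SteadyLattice.freqNormSq_eq_zero`),
while for `k = 0` both the summand and `‖z 0‖²` vanish (`freqNormSq_zero`, hypothesis `z 0 = 0`).  Hence the
series is `∑ₖ ‖z k‖² = ‖z‖²` (`SteadyLattice.l2_norm_sq_eq_tsum`, i.e. Mathlib's `lp.hasSum_norm` at `p = 2`),
by `tsum_congr`.
-/

-- `Summit.<Summit>.<Problem>` is the tree's mandated summit-side namespace (CONVENTIONS §2); for this
-- single-conjunct summit the two coincide, so the duplicate is deliberate.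
set_option linter.dupNamespace false

noncomputable section

open scoped BigOperators Topology ENNReal NNReal InnerProductSpace ComplexConjugate
open Filter Set Function TopologicalSpace MeasureTheory UnitAddTorus

namespace Summit.AnomalousDissipation.AnomalousDissipation.Theorems.RobustLoudUpgrade.LsFamilyDist

open Literature.Analysis.FunctionSpaces Literature.Analysis.FunctionSpaces.Torus
open Literature.Analysis.FunctionSpaces.EuclideanSpace
open Literature.Analysis.FluidPDE
open Literature.Analysis.FluidPDE.ScalarFourier
open Literature.Analysis.FluidPDE.SteadyLattice

/-- Termwise identity behind `lsFamily_latticeDist`: `|k|⁴ ‖(cf z) k‖² = ‖z k‖²` for every lattice point `k`,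
the zero mode being covered by the hypothesis `z 0 = 0`. [folklore] -/
private theorem weight_sq_mul_norm_cf_sq (z : (Fin 3 → ℤ) → EuclideanSpace ℂ (Fin 3)) (hz0 : z 0 = 0)
    (k : Fin 3 → ℤ) :
    freqNormSq k ^ 2 *
        ‖(((fun mm : Fin 3 → ℤ => (((freqNormSq mm)⁻¹ : ℝ) : ℂ)) •
            (z : (Fin 3 → ℤ) → EuclideanSpace ℂ (Fin 3)))) k‖ ^ 2 = ‖z k‖ ^ 2 := by
  rw [norm_cf z k]
  by_cases hk : k = 0
  · subst hk
    rw [hz0, norm_zero, mul_zero, freqNormSq_zero]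
    simp
  · have hf : freqNormSq k ≠ 0 := fun h0 => hk (freqNormSq_eq_zero.1 h0)
    rw [mul_pow, ← mul_assoc, ← mul_pow, mul_inv_cancel₀ hf, one_pow, one_mul]

/-- **Part lemma `lsFamily_latticeDist` of `stub_lsFamily`** (line `malkin-cone-group-orbits`, companion c2):
if the lattice state `z ∈ ℓ²(ℤ³; ℂ³)` has vanishing zero mode and `cf z = (|k|⁻² z k)ₖ` is the Fourier
coefficient family of the (complexified) real field `w`, then the weighted `H²`-type quantity
`∑ₖ |k|⁴ ‖ŵ(k)‖²` equals `‖z‖²`. [folklore] -/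
theorem lsFamily_latticeDist :
    ∀ (z : lp (fun _ : Fin 3 → ℤ => EuclideanSpace ℂ (Fin 3)) 2)
      (w : UnitAddTorus (Fin 3) → EuclideanSpace ℝ (Fin 3)),
      (z : (Fin 3 → ℤ) → EuclideanSpace ℂ (Fin 3)) 0 = 0 →
      ((fun mm : Fin 3 → ℤ => (((freqNormSq mm)⁻¹ : ℝ) : ℂ)) •
          ((z : (Fin 3 → ℤ) → EuclideanSpace ℂ (Fin 3)))) = mFourierCoeff (complexify ∘ w) →
      (∑' k : Fin 3 → ℤ, freqNormSq k ^ 2 * ‖mFourierCoeff (complexify ∘ w) k‖ ^ 2) = ‖z‖ ^ 2 := by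
  intro z w hz0 h
  rw [l2_norm_sq_eq_tsum z, ← h]
  exact tsum_congr fun k => weight_sq_mul_norm_cf_sq (z : (Fin 3 → ℤ) → EuclideanSpace ℂ (Fin 3)) hz0 k

end Summit.AnomalousDissipation.AnomalousDissipation.Theorems.RobustLoudUpgrade.LsFamilyDist

end
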